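import Summits.Parity.GeneralizedHardyLittlewood.Theorems.FordMaynardNoSieveConst0164NegWitness0164SliceFour
import Summits.Parity.GeneralizedHardyLittlewood.Theorems.FordMaynardNoSieveConst0164NegWitness0164OneClause
import Summits.Parity.GeneralizedHardyLittlewood.Theorems.FordMaynardNoSieveConst0164NegWitness0164BlockWeightSmall
import Literature.NumberTheory.Sieve.FordMaynardSliceConvolution

/-!
# Route `FordMaynardNoSieveConst0164`, crux `NegWitness0164` (stmt-Parity-19102), line `birth`,
# stub `stub_tweakNeg0164`: the `k = 1` clause reduced to the three-, five- and six-piece terms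

Ninth helper file toward the certificate stub (K. Ford, J. Maynard, *On the theory of prime producing
sieves*, arXiv:2407.14368, §8, proof of Theorem 2.7 (c): "`f(1) = I₃ + I₅`").  The helper file `…OneClause`
reduced the `k = 1` clause of the stub to
`h(1) = ∑_{n=1}^{6} sliceIntegral n 1 (v ↦ 𝟙[v ≥ 41/250] · blockWeight (1/2) n v · F₀ n v)`; here the terms
`n = 1` (the block `(1)` has a piece `≥ 1/2`: weight `0`, Lemma 5.5 (a)), `n = 2` (one of two pieces of `1`
is `≥ 1/2`: weight `0`) and `n = 4` (helper file `…SliceFour`: weight `0` almost everywhere) are removed,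
and the three-piece weight is made explicit (`blockWeight (1/2) 3 v = 1/(3 v₀v₁v₂)` when all `vᵢ < 1/2`,
`0` otherwise), leaving

  `h(1) = ∫_{|v|=1} 𝟙[41/250 ≤ vᵢ < 1/2] F₀(v₀,v₁,v₂)/(3 v₀v₁v₂) + S₅(F₀) + S₆(F₀)`

(`S₅, S₆` the five- and six-piece slice terms, whose Linnik weights are the subject of the next files).
With `F₀ ≡ -1` in dimension `3` the first term is Ford–Maynard's `I₃(ν)` at `ν = 41/250`.  Def-free.

References: [FordMaynard2024PrimeSieves] arXiv:2407.14368, §8 (proof of Theorem 2.7 (c)), Lemma 5.5 (a),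
§6.1 (6.3).
-/

noncomputable section

open Finset MeasureTheory
open scoped Classical
open Literature.Combinatorics.Enumerative
open Literature.NumberTheory.Sieve Literature.NumberTheory.Sieve.FordMaynard

namespace Summit.Parity.GeneralizedHardyLittlewood.FordMaynardNoSieveConst0164NegWitness0164

/-- **The one-piece term of `h(1)` vanishes**: the block `(1)` has its piece `≥ 1 - γ = 1/2`, so
`blockWeight (1/2) 1 (1) = 0` and `sliceIntegral 1 1 (𝟙 · blockWeight (1/2) 1 · F) = 0`.
[cite: FordMaynard2024PrimeSieves, Lemma 5.5 (a) and §6.1 (remarks after (6.3))] -/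
theorem sliceIntegral_one_one_indicator_blockWeight_half (η : ℝ) (F : (Fin 1 → ℝ) → ℝ) :
    sliceIntegral 1 1 (fun v => if ∀ t, η ≤ v t then blockWeight (1 / 2) 1 v * F v else 0) = 0 := by
  rw [sliceIntegral_one, if_pos one_pos]
  split_ifs with h
  · rw [blockWeight_one_eq_zero_of_le _ (by norm_num) (by norm_num), zero_mul]
  · rfl

/-- **A two-piece fragmentation of `1` has weight `0`** (`γ = 1/2`): one of `v₀, v₁` with `v₀ + v₁ = 1` is
`≥ 1/2`, so `𝓛_{1/2}(v) = 0` by Lemma 5.5 (a). [cite: FordMaynard2024PrimeSieves, Lemma 5.5 (a)] -/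
theorem blockWeight_half_two_of_sum_one (v : Fin 2 → ℝ) (hpos : ∀ i, 0 < v i) (hs : ∑ i, v i = 1) :
    blockWeight (1 / 2) 2 v = 0 := by
  rw [Fin.sum_univ_two] at hs
  unfold blockWeight
  by_cases h : 1 - 1 / 2 ≤ v 0
  · rw [linnikFn_eq_zero_of_mem (1 - 1 / 2) v (Finset.mem_univ 0) h fun k _ => (hpos k).le, zero_div]
  · rw [linnikFn_eq_zero_of_mem (1 - 1 / 2) v (Finset.mem_univ 1) (by push Not at h; linarith)
      fun k _ => (hpos k).le, zero_div]

/-- **The two-piece term of `h(1)` vanishes**: `sliceIntegral 2 1 (𝟙 · blockWeight (1/2) 2 · F) = 0` for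
every `η` and `F`. [cite: FordMaynard2024PrimeSieves, §8 (proof of Theorem 2.7 (c)) and Lemma 5.5 (a)] -/
theorem sliceIntegral_two_one_indicator_blockWeight_half (η : ℝ) (F : (Fin 2 → ℝ) → ℝ) :
    sliceIntegral 2 1 (fun v => if ∀ t, η ≤ v t then blockWeight (1 / 2) 2 v * F v else 0) = 0 := by
  rw [sliceIntegral_congr (G' := fun _ => 0) (fun v hpos hs => by
    simp only [blockWeight_half_two_of_sum_one v hpos hs, zero_mul, ite_self]), sliceIntegral_zero]

/-- **The three-piece weight on the slice `|v| = 1`** (`γ = 1/2`): for `v ∈ (0,∞)³` with `v₀ + v₁ + v₂ = 1`,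
`blockWeight (1/2) 3 v = 1/(3 v₀v₁v₂)` if all `vᵢ < 1/2` (then every pair sums to `1 - vₖ > 1/2`,
`𝓛_{1/2}(v) = 2`), and `0` otherwise (Lemma 5.5 (a)).
[cite: FordMaynard2024PrimeSieves, §8 ("if x ∈ 𝓗₃ with all components < 1/2 then 𝓛_{1/2}(x) = 2") and Lemma 5.5 (a)] -/
theorem blockWeight_half_three_of_sum_one (v : Fin 3 → ℝ) (hpos : ∀ i, 0 < v i) (hs : ∑ i, v i = 1) :
    blockWeight (1 / 2) 3 v = if ∀ i, v i < 1 / 2 then 1 / (3 * (v 0 * v 1 * v 2)) else 0 := by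
  rw [Fin.sum_univ_three] at hs
  split_ifs with h
  · exact blockWeight_three_eq v (fun i => by linarith [h i]) (by linarith [h 2]) (by linarith [h 1])
      (by linarith [h 0])
  · push Not at h
    obtain ⟨i, hi⟩ := h
    unfold blockWeight
    rw [linnikFn_eq_zero_of_mem (1 - 1 / 2) v (Finset.mem_univ i) (by linarith) fun k _ => (hpos k).le,
      zero_div]

/-- **The three-piece term of `h(1)` made explicit**:
`sliceIntegral 3 1 (𝟙[v ≥ η] · blockWeight (1/2) 3 · F) = sliceIntegral 3 1 (𝟙[η ≤ vᵢ < 1/2] · F(v)/(3 v₀v₁v₂))`.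
[cite: FordMaynard2024PrimeSieves, §8 (proof of Theorem 2.7 (c), the integral I₃)] -/
theorem sliceIntegral_three_one_indicator_blockWeight_half (η : ℝ) (F : (Fin 3 → ℝ) → ℝ) :
    sliceIntegral 3 1 (fun v => if ∀ t, η ≤ v t then blockWeight (1 / 2) 3 v * F v else 0) =
      sliceIntegral 3 1 (fun v => if (∀ t, η ≤ v t) ∧ (∀ t, v t < 1 / 2) then
        F v / (3 * (v 0 * v 1 * v 2)) else 0) := by
  refine sliceIntegral_congr fun v hpos hs => ?_
  rw [blockWeight_half_three_of_sum_one v hpos hs]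
  by_cases h1 : ∀ t, η ≤ v t
  · by_cases h2 : ∀ t, v t < 1 / 2
    · rw [if_pos h1, if_pos h2, if_pos ⟨h1, h2⟩]; ring
    · rw [if_pos h1, if_neg h2, if_neg (fun h => h2 h.2), zero_mul]
  · rw [if_neg h1, if_neg (fun h => h1 h.1)]

/-- **The `k = 1` clause of `stub_tweakNeg0164`, reduced to the three-, five- and six-piece terms**: for raw
data `F₀` (piecewise Lipschitz in each dimension, supported on `{ξᵢ ≥ 41/250, Σ ξ = 1}`),
`h(1) = sliceIntegral 3 1 (𝟙[41/250 ≤ vᵢ < 1/2] F₀(v)/(3v₀v₁v₂)) + S₅(F₀) + S₆(F₀)` with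
`Sₙ(F₀) = sliceIntegral n 1 (𝟙[v ≥ 41/250] · blockWeight (1/2) n · F₀ n)`: the one-, two- and four-piece
terms of `…OneClause` vanish.
[cite: FordMaynard2024PrimeSieves, §8 (proof of Theorem 2.7 (c), "Thus, f(1) = I₃ + I₅")] -/
theorem tweak_one_eq_three_five_six_0164 {F₀ : VecFn} (hpl : ∀ k, IsPiecewiseLipschitz (F₀ k))
    (hsupp : ∀ (k : ℕ) (ξ : Fin k → ℝ), F₀ k ξ ≠ 0 → (∀ i, (41 / 250 : ℝ) ≤ ξ i) ∧ ∑ i, ξ i = 1) :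
    tweak (1 / 2) (41 / 250) Fin.elim0 Fin.elim0 F₀ 1 (fun _ => 1) =
      sliceIntegral 3 1 (fun v => if (∀ t, (41 / 250 : ℝ) ≤ v t) ∧ (∀ t, v t < 1 / 2) then
          F₀ 3 v / (3 * (v 0 * v 1 * v 2)) else 0) +
        sliceIntegral 5 1
          (fun v => if ∀ t, (41 / 250 : ℝ) ≤ v t then blockWeight (1 / 2) 5 v * F₀ 5 v else 0) +
        sliceIntegral 6 1
          (fun v => if ∀ t, (41 / 250 : ℝ) ≤ v t then blockWeight (1 / 2) 6 v * F₀ 6 v else 0) := by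
  rw [tweak_one_eq_sum_sliceIntegral_0164 hpl hsupp, show Finset.Icc 1 6 = {1, 2, 3, 4, 5, 6} from by decide,
    Finset.sum_insert (by decide), Finset.sum_insert (by decide), Finset.sum_insert (by decide),
    Finset.sum_insert (by decide), Finset.sum_pair (by decide),
    sliceIntegral_one_one_indicator_blockWeight_half, sliceIntegral_two_one_indicator_blockWeight_half,
    sliceIntegral_three_one_indicator_blockWeight_half, sliceIntegral_four_one_indicator_blockWeight_half]
  ring

end Summit.Parity.GeneralizedHardyLittlewood.FordMaynardNoSieveConst0164NegWitness0164

end
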